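import Summits.QuantumFields.YangMills.Theorems.BalabanUVNodesK0AxJoinTKStep

/-!
# LANDING NOTE (porter PTC-1 g3, 2026-08-31; AUTHORSHIP = ◇ lens-1 g9 «cauchy-analytic», HOME sketch `nodeO-cover/LENS-1g9-JoinT-KW-v1.lean` sha16 f7071885d85ae29e · 341 l. · 0 sorry;
# ◆ CRIT-1 g36 CUT §W = PASS 08:42:36Z with landing note (L): «§W ALONE, re-based on the tree's `…K0AxJoinTKStep` — the sketch's §K re-declares ✓p817093's six declarations»).
# THIS FILE `…K0AxJoinTGeomW.lean` = the sketch's §W `section GeomWitness` VERBATIM: (W1) `eventually_window_recordRNat` = (G3b) at the witness `Nin := recordRNat` (record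
# fact S); (W2) `rateRows_recordW` = (G4) at `Rsep := recordR∕2 − 2·Mc`, `cR := 1∕16` (record fact S); (W3) ★★★ `kstep_joinT_at_record_W` = ✓`kstep_joinT_at_record` (✓p817093)
# with `Nin ∕ Rsep ∕ cR` INSTANTIATED at those witnesses and (G3)(G4) fed by (W1)(W2) — hypotheses left: constants, `McGuard`, D1 (⁸'s `FormatPlusG` at `recordEmbJ` on
# `]0, γ₀]`-runs), the swap row, D9 (`Response9DAtJC`, centred) + D13, (G0) `InjOn recordDomEmbCtr` off `recordWrapCtr`, (G1)(G2) LARGE-OR-FAR at `recordR∕2 − 2·Mc`, leaves;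
# conclusion [E] `RecordPvolTwoVolExpOnRunsAx F a₀ ε₂₉ γ₀ (48E₀C₉²K₀′K₁ + 32E₀C₉²e^{δ₁·Mg·c₁}K₀′K₁) (δ₁·(1∕16))`.  Imports ✓`…K0AxJoinTKStep` only; the author's module docstring follows.
# HONEST: (W1)(W2) elementary record bookkeeping, (W3) a CHECKED IMPLICATION between displayed hypotheses; [E] inhabited unconditionally NOWHERE; (G0)(G1)(G2) unfiled (hands
# geomA∕geomB); K0ᴬ stmt-QuantumFields-27238 OPEN — NOTHING of it proved; nothing of Bałaban asserted, ported, discharged or refuted; NODE O 0∕1; COUNT 8∕28 · K 1∕4 UNMOVED;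
# finite 𝕋⁴ at fixed ε — NOT continuum ∕ OS ∕ Clay; the Yang–Mills mass gap is NOT proved by any of this.
-/

/-!
# LENS-1 g9 «cauchy-analytic» — JOIN-T §K: THE KERNEL STEP AT THE RECORD, PROVED — ⁸'s mould + DEF-1's centred receipt + identities + LARGE-OR-FAR geometry rows ⇒ [E]
(unit `ymgap-nodeO-lens-1-g9`, GEN 9; HOME sketch `nodeO-cover/LENS-1g9-JoinT-K-v2.lean` = §K of `nodeO-cover/LENS-1g9-JoinT-v2.lean` (b7b49705adbb81b3; ◆ CRIT-1 g36 CUT PASS, STATUS l.4915)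
re-based on the TREE: ✓p816700 `…K0AxJoinTLeaves` (§A+§B) · ✓p816793 `…K0AxJoinT` (§C+§D) · ✓ `…K0AxJoinTRecord` (§E) — all landed by ▶ PTC-1 g3 `--supports stmt-QuantumFields-27238 --as helper`;
nobody's tree file; count-neutral; candidate tree name `Summits/QuantumFields/YangMills/Theorems/BalabanUVNodesK0AxJoinTKernel.lean`, same `--supports … --as helper`.)

[I] = [Balaban1987RG1], [15] = [Balaban1985Variational].  [E] = `K0AxTwoVolumeRate.RecordPvolTwoVolExpOnRunsAx` (✓p814710 :231).

CONTENT: `flipJC` (= the JOIN's `flipL` device ✓`PortHRecordJoinDefs.flipL` on DEF-1 ed.19's CENTRED literal `recordResponse9DataFromJC`: only the label map `e` is flipped `z ↦ −z`, so that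
`R.e n μ (−z) = recordE … μ z` as ★★★'s kernel convention wants), `flipJC_e`, `response9D_flipJC` (`Response9DAtJC` ⟹ `Response9D (flipJC …) recordChartJ recordRNat recordDom44J C₉ δ₀`; the
window guard is `|·|`-symmetric), `chart_cut_members_JC` (✓`PortHRecordJoin.chart_cut`), the member-level ★★★ `recordTwoVol_of_rows_JC` (= the tree's ★★★ `twoVol_pvolOf_of_rows_trace` at the
record names: `R := flipJC …`, `Gc n a := recordGkJC … a`, dressed chart `ιC` via ✓`formatPlusG_chartSwap`, `Chart44D` = ✓`K0PortChart44DAtRecord.chart44DJ_record`, RowG = ✓`chartEquivariant_members`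
∕ ✓`noInvariantCovector_members`; (G1)(G2) bridged `z ↦ −z` by `flipJC_e`), and the run-level `kstep_joinT_at_record` (via the tree's §E `recordPvolTwoVolExpOnRunsAx_of_members` +
✓`B12Decay510.delta1_pos ∕ delta1_le_half`).  TYPING NOTE: the instantiation NEEDS `open scoped Matrix.Norms.L2Operator` (`NormedRing (Node00.MatA 2)` for `θ.ρ8` in ★★★'s `ρ` slot).
ROWS DISPLAYED (◆ CRIT-1 g36 price sheet `Cruxes/Record13SepCoPHInhabited/CRIT-1-DROWS-v2prime-g36.md`): D1 ⁸'s `FormatPlusG` mould VERBATIM at `recordEmbJ` along `]0,γ₀]`-runs; the swap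
row to `ιC`; D9 the CENTRED-PAIR receipt ✓`Response9DAtJC` (per colour; window `recordRNat`); D13 `ContDiffAt ℝ 2 (ιC k n) 0 ∧ ιC k n 0 = 0` + the response link on `recordGkJC` (= DEF-1's
`recordEmbJC_zero_thetaFill` ∕ `recordGkJC_link_thetaFill` at `ιC := recordEmbJC`, №534); (G0) `InjOn recordDomEmbCtr` off `recordWrapCtr`; (G1)(G2) LARGE-OR-FAR at a displayed `Rsep k n`
for the inner window `Nin k n`; (G3) `Nin ≤ recordRNat` + eventual membership; (G4) `cR·recordN ≤ Rsep`, `recordN∕4 ≤ recordRNat`; leaves (δ₀∕4, κ∕4).  J1′ (◆ l.4915): rows jointly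
satisfiable at the record with `Nin := recordRNat`, `Rsep := recordR∕2 − 2Mc` (q ≥ 16; else `Nin := 0`, `Rsep := recordN`), `cR := 1∕16`, `Mg ≥ 4Mc` — hands geomA ((G0)(G3)(G4)) ∕ geomB ((G1)(G2)).
NO `…FromCtr ∕ FromJ ∕ FromL`, NO `Response9DAtL ∕ ConsumerC1 ∕ TokP9L4New ∕ TokRest4`, NO `= … univ` bridge.

HONEST FRAMING.  CONDITIONAL helpers over DISPLAYED row predicates; NO `sorry`; [E] follows from the displayed rows by a checked theorem and is inhabited UNCONDITIONALLY nowhere (its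
suppliers — ⁸'s consequent and `Response9DAtJC` — are OPEN); nothing of Bałaban ([I] Thm 1, (1.7), (1.18)–(1.22), (4.33)–(4.37), (5.10); [15] Thm 1, Prop. 9, (190)) is asserted,
ported, discharged or refuted; K0⁷ stmt-QuantumFields-20541 ∕ K0ᴬ stmt-QuantumFields-27238 OPEN; NODE O 0∕1; COUNT 8∕28 · K 1∕4 UNMOVED; finite `𝕋⁴_{L^K}` at fixed ε — NOT continuum ∕
ℝ⁴ ∕ OS ∕ Clay; **the Yang–Mills mass gap is NOT proved by any of this.**  No `instance`, `notation`, `allowUnsafeReducibility`; standard axioms.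
-/

noncomputable section

open Filter Topology
open scoped BigOperators Matrix.Norms.L2Operator

namespace Summit.QuantumFields.YangMills.Theorems.K0AxJoinT

open Literature.MathematicalPhysics.QuantumFieldTheory.Balaban1983to89
open Literature.MathematicalPhysics.QuantumFieldTheory.Balaban1983to89.Node00 (TermFamily1 siteOfInt polWindow polScalar betaOfRecord₁₃Ax Stage13Params)
open Literature.MathematicalPhysics.QuantumFieldTheory.Balaban1983to89.T4Continuum (T4Family)
open Literature.MathematicalPhysics.QuantumFieldTheory.Balaban1983to89.B12FormatPlus
open Literature.MathematicalPhysics.QuantumFieldTheory.Balaban1983to89.B12Decay510 (SiteGeometry GeomLeaf CubeSumLeaf TreeLeaf KernelBound delta1 mixedDeriv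
  sum_abs_le delta1_le_half delta1_mul_le delta1_nonneg)
open Literature.MathematicalPhysics.QuantumFieldTheory.Balaban1983to89.B12Decay510Gauge (norm_mixedDeriv_le_gauge kernelBound_of_gauge)
open Literature.MathematicalPhysics.QuantumFieldTheory.Balaban1983to89.B12Decay510TwoVolume (kernelBound_twoVolume_of_gauge mixedDeriv_nextMember_eq maskKernel
  sum_filter_abs_eq_sum_abs_maskKernel comapLabels abs_sum_next_sub_sum_le_three)
open Literature.MathematicalPhysics.QuantumFieldTheory.Balaban1983to89.B12Eq435SecondVariation (ofReal_fderiv_fderiv_eq_sum_mixedDeriv_of_repr)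
open Literature.MathematicalPhysics.QuantumFieldTheory.Balaban1983to89.Beta.RemainderLocality (mixedDeriv_comp_clm mixedDeriv_eq_fderiv_fderiv
  differentiableAt_fderiv_of_analyticAt)
open Summit.QuantumFields.YangMills.Theorems.K0RecordFormatNames (ΦfOf pvolOf plimOf)
open Summit.QuantumFields.YangMills.Theorems.PortH (exists_cutTo_clm pvolOf_eq_trace)

/-! ## §W  THE RECORD WITNESSES FOR (G3)(G4) (◆ CRIT-1 g36's J1′ joint-satisfiability choice, STATUS l.4915, made a theorem): inner window `Nin := recordRNat`, seam separation
`Rsep := recordR∕2 − 2·Mc`, `cR := 1∕16`.  Under `McGuard` every member has `q∕2 ≥ L ≥ 12` cubes per half-direction (✓`PortHRecordRowG.le_domCount_div_two`, `F.hL11`), so NO case split is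
needed: (G3a) is `le_rfl`, (G3b) is ✓`two_pow_le_recordRNat`, (G4) is ✓`recordN_eq_domCount_mul` ∕ ✓`recordN_div_four_le_recordR` ∕ ✓`recordR_eq_cast_recordRNat` + linear arithmetic.
COROLLARY `kstep_joinT_at_record_W`: [E] at rate `δ₁∕16` from D1 · swap · D9+D13 · (G0) · (G1)(G2) AT THESE WITNESSES · leaves — i.e. EXACTLY the targets of hands geomA ((G0)) and geomB ((G1)(G2),
for their `Mg ≥ 4·Mc`); nothing else of the geometry remains.  [cite: Balaban1987RG1, (1.21) p.264, p.257 (bookkeeping)] -/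

section GeomWitness

open Summit.QuantumFields.YangMills.Theorems.K0RecordFormatNames
open Summit.QuantumFields.YangMills.Theorems.K0AxTwoVolumeRate (RecordPvolTwoVolExpOnRunsAx)
open Summit.QuantumFields.YangMills.Theorems.PortHRecordRowG (le_domCount_div_two two_pow_le_recordRNat)
open Literature.MathematicalPhysics.QuantumFieldTheory.Balaban1983to89.Node00.Sect2 (domCount)
open Literature.MathematicalPhysics.QuantumFieldTheory.Balaban1983to89.FlowStep
open Literature.MathematicalPhysics.QuantumFieldTheory.Balaban1983to89.FlowStepRuns

variable {F : T4Family}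

/-- (G3b) AT THE WITNESS `Nin := recordRNat`: every fixed lattice label is eventually inside the inner window (the window radius at least doubles along the members).
[cite: Balaban1987RG1, (1.21) p.264 (bookkeeping)] -/
theorem eventually_window_recordRNat {Mc : ℕ} (hMc : McGuard F Mc) (k : ℕ) (z : Fin 4 → ℤ) :
    ∀ᶠ n in atTop, ∀ l, 2 * |z l| < (recordRNat F Mc k (recordK₀ F Mc k + n) : ℤ) := by
  obtain ⟨B, hB⟩ : ∃ B : ℕ, ∀ l, (z l).natAbs ≤ B :=
    ⟨Finset.univ.sup fun l => (z l).natAbs, fun l => Finset.le_sup (f := fun l => (z l).natAbs) (Finset.mem_univ l)⟩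
  have ht : Tendsto (fun n : ℕ => 2 ^ n) atTop atTop := tendsto_pow_atTop_atTop_of_one_lt (by norm_num : (1 : ℕ) < 2)
  filter_upwards [ht.eventually_ge_atTop (2 * B + 1)] with n hn l
  have h1 : ((2 * B + 1 : ℕ) : ℤ) ≤ (recordRNat F Mc k (recordK₀ F Mc k + n) : ℤ) := by
    exact_mod_cast hn.trans (two_pow_le_recordRNat hMc k n)
  have h2 : |z l| ≤ (B : ℤ) := by
    have := hB l
    rw [Int.abs_eq_natAbs]
    exact_mod_cast this
  push_cast at h1
  linarith

/-- (G4) AT THE WITNESSES `Rsep := recordR∕2 − 2·Mc`, `cR := 1∕16`: `recordN∕16 ≤ recordR∕2 − 2Mc` and `recordN∕4 ≤ recordRNat` at every member (under `McGuard`, `q∕2 ≥ L ≥ 12`).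
[cite: Balaban1987RG1, (1.21) p.264, p.257 (bookkeeping)] -/
theorem rateRows_recordW {Mc : ℕ} (hMc : McGuard F Mc) (k n : ℕ) :
    (1 / 16 : ℝ) * (recordN F k (recordK₀ F Mc k + n) : ℝ) ≤ recordR F Mc k (recordK₀ F Mc k + n) / 2 - 2 * (Mc : ℝ) ∧
      (recordN F k (recordK₀ F Mc k + n) : ℝ) / 4 ≤ (recordRNat F Mc k (recordK₀ F Mc k + n) : ℝ) := by
  have hK : recordK₀ F Mc k ≤ recordK₀ F Mc k + n := Nat.le_add_right _ _
  have hh := le_domCount_div_two (k := k) hMc hK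
  have hL : 11 < F.L := F.hL11
  have hq2 : 2 ≤ domCount (F.P (recordK₀ F Mc k + n)) Mc (k + 1) := by omega
  refine ⟨?_, by rw [← recordR_eq_cast_recordRNat]; exact recordN_div_four_le_recordR hMc hK hq2⟩
  have hMc0 : (0 : ℝ) ≤ Mc := Nat.cast_nonneg _
  rw [recordN_eq_domCount_mul hMc hK]
  unfold recordR
  generalize domCount (F.P (recordK₀ F Mc k + n)) Mc (k + 1) = q at *
  have h12 : (12 : ℝ) ≤ ((q / 2 : ℕ) : ℝ) := by exact_mod_cast (by omega : 12 ≤ q / 2)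
  have hqle : (q : ℝ) ≤ 2 * ((q / 2 : ℕ) : ℝ) + 1 := by exact_mod_cast (by omega : q ≤ 2 * (q / 2) + 1)
  have hp1 := mul_le_mul_of_nonneg_right h12 hMc0
  have hp2 := mul_le_mul_of_nonneg_right hqle hMc0
  rw [Nat.cast_mul]
  nlinarith [hp1, hp2, hMc0]

/-- ★★★ **`kstep_joinT_at_record_W` — THE KERNEL STEP WITH THE (G3)(G4) WITNESSES DISCHARGED** (`Nin := recordRNat`, `Rsep := recordR∕2 − 2·Mc`, `cR := 1∕16`, under `McGuard`):
[E] at rate `δ₁∕16` from D1 (⁸'s mould at `recordEmbJ` on `]0,γ₀]`-runs) · the swap row · D9 + D13 · (G0) · (G1)(G2) AT THE WITNESSES · leaves.  What remains of the geometry is EXACTLY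
(G0) (hand geomA) and (G1)(G2) (hand geomB, at its `Mg ≥ 4·Mc`).  CONDITIONAL; nothing of Bałaban asserted. [cite: Balaban1987RG1, Thm 1 p.257, (1.18)–(1.21) pp.263–264, (1.7) p.261] -/
theorem kstep_joinT_at_record_W {E₀ κ C₉ δ₀ Mg c₁ K₀' K₁ : ℝ}
    (hE₀ : 0 ≤ E₀) (hκ : 0 < κ) (hC₉ : 0 ≤ C₉) (hδ₀ : 0 < δ₀) (hMg : 0 < Mg) (hK₀' : 0 ≤ K₀') :
    ∀ (F : T4Family) (a₀ ε₂₉ γ₀ α₀ α₁ : ℝ), 0 < α₀ → 0 < α₁ → ∀ (Mc : ℕ), McGuard F Mc →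
      letI θ := thetaFill F a₀ ε₂₉; letI := θ.instVβ₁; letI := θ.instVβ₂; letI := θ.instιβ
      ∀ ιC : (k n : ℕ) → recordW F a₀ ε₂₉ k (recordK₀ F Mc k + n) → (Fin (recordChartDimJ F (recordK₀ F Mc k + n)) → ℂ),
      (∀ (k : ℕ) (g : ℕ → ℝ), FlowStep.RGEqH k (betaOfRecord₁₃Ax F 2 (thetaFill F a₀ ε₂₉)) g → Step.InInterval γ₀ k g →
        B12FormatPlus.FormatPlusG (fun n => recordDomSys F Mc k (recordK₀ F Mc k + n)) (fun n => recordBondCount F (recordK₀ F Mc k + n))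
          (fun n => recordAct F (recordK₀ F Mc k + n)) (fun n => recordUc F Mc k α₀ α₁ (recordK₀ F Mc k + n))
          (fun n => recordCoords F Mc k (recordK₀ F Mc k + n)) (fun n => recordChartDimJ F (recordK₀ F Mc k + n))
          (fun n => recordChartJ F Mc k (recordK₀ F Mc k + n)) (fun n => recordΦfAx F a₀ ε₂₉ k (FlowStep.prefixOf g k) (recordK₀ F Mc k + n))
          (fun n => recordEmbJ F θ k (recordK₀ F Mc k + n)) (fun n => recordWrapCtr F Mc k (recordK₀ F Mc k + n))
          (fun n => recordDomEmbCtr F Mc k (recordK₀ F Mc k + n)) (fun n _ => recordCoordProjCtr F (recordK₀ F Mc k + n)) E₀ κ) →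
      (∀ (k n : ℕ), ∀ᶠ B in 𝓝 (0 : recordW F a₀ ε₂₉ k (recordK₀ F Mc k + n)), ∀ X : (recordDomSys F Mc k (recordK₀ F Mc k + n)).Dom,
          ∃ g : recordGaugeGrp F (recordK₀ F Mc k + n), ∀ i ∈ recordCoords F Mc k (recordK₀ F Mc k + n) X,
            recordChartJ F Mc k (recordK₀ F Mc k + n) X (ιC k n B) i =
              recordAct F (recordK₀ F Mc k + n) g (recordChartJ F Mc k (recordK₀ F Mc k + n) X (recordEmbJ F θ k (recordK₀ F Mc k + n) B)) i) →
      (∀ k : ℕ, (∀ a : θ.ιβ, Response9DAtJC F θ a Mc k (recordK₀ F Mc k) (min (1 / 4 : ℝ) (min α₁ (α₀ / 36))) C₉ δ₀) ∧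
          (∀ n : ℕ, ContDiffAt ℝ 2 (ιC k n) 0 ∧ ιC k n 0 = 0) ∧
          ∀ (n : ℕ) (a : θ.ιβ) (l : RespLabel F k (recordK₀ F Mc k + n)),
            recordGkJC F θ k (recordK₀ F Mc k + n) a l = fun i => fderiv ℝ (ιC k n) 0 (Pi.single l.1 (Pi.single l.2 (θ.bV a))) i) →
      (∀ k n : ℕ, Set.InjOn (recordDomEmbCtr F Mc k (recordK₀ F Mc k + n)) {X | X ∉ recordWrapCtr F Mc k (recordK₀ F Mc k + n)}) →
      (∀ (k n : ℕ) (X : (recordDomSys F Mc k (recordK₀ F Mc k + n)).Dom), X ∈ recordWrapCtr F Mc k (recordK₀ F Mc k + n) →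
          ∀ (μ : Fin 4) (z : Fin 4 → ℤ), (∀ l, 2 * |z l| < (recordRNat F Mc k (recordK₀ F Mc k + n) : ℤ)) →
            recordR F Mc k (recordK₀ F Mc k + n) / 2 - 2 * (Mc : ℝ) ≤
              (recordSiteGeom F Mc k (recordK₀ F Mc k + n)).distD (recordE F k (recordK₀ F Mc k + n) μ z) X +
                Mg * ((recordDomSys F Mc k (recordK₀ F Mc k + n)).dj X + c₁)) →
      (∀ (k n : ℕ) (X' : (recordDomSys F Mc k (recordK₀ F Mc k + (n + 1))).Dom),
          (∀ X, X ∉ recordWrapCtr F Mc k (recordK₀ F Mc k + n) → recordDomEmbCtr F Mc k (recordK₀ F Mc k + n) X ≠ X') →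
          ∀ (μ : Fin 4) (z : Fin 4 → ℤ), (∀ l, 2 * |z l| < (recordRNat F Mc k (recordK₀ F Mc k + n) : ℤ)) →
            recordR F Mc k (recordK₀ F Mc k + n) / 2 - 2 * (Mc : ℝ) ≤
              (recordSiteGeom F Mc k (recordK₀ F Mc k + (n + 1))).distD (recordE F k (recordK₀ F Mc k + (n + 1)) μ z) X' +
                Mg * ((recordDomSys F Mc k (recordK₀ F Mc k + (n + 1))).dj X' + c₁)) →
      (∀ k n : ℕ, B12Decay510.CubeSumLeaf (recordSiteGeom F Mc k (recordK₀ F Mc k + n)) (δ₀ / 4) K₁ ∧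
          B12Decay510.TreeLeaf (recordCc F Mc k (recordK₀ F Mc k + n)) (κ / 4) K₀') →
      RecordPvolTwoVolExpOnRunsAx F a₀ ε₂₉ γ₀
        (48 * E₀ * C₉ ^ 2 * K₀' * K₁ + 32 * E₀ * C₉ ^ 2 * Real.exp (B12Decay510.delta1 δ₀ κ Mg * Mg * c₁) * K₀' * K₁)
        (B12Decay510.delta1 δ₀ κ Mg * (1 / 16)) := by
  intro F a₀ ε₂₉ γ₀ α₀ α₁ hα₀ hα₁ Mc hMc ιC h8 hsw h9 hinj hsepW hsepF hleaf
  exact kstep_joinT_at_record hE₀ hκ hC₉ hδ₀ hMg hK₀' F a₀ ε₂₉ γ₀ α₀ α₁ hα₀ hα₁ Mc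
    (fun k n => recordRNat F Mc k (recordK₀ F Mc k + n)) (fun k n => recordR F Mc k (recordK₀ F Mc k + n) / 2 - 2 * (Mc : ℝ)) (1 / 16)
    (by norm_num) (by norm_num) ιC h8 hsw h9 hinj hsepW hsepF (fun k n => le_rfl) (fun k z => eventually_window_recordRNat hMc k z)
    (fun k n => rateRows_recordW hMc k n) hleaf

end GeomWitness

end Summit.QuantumFields.YangMills.Theorems.K0AxJoinT

end
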